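import Mathlib
import HarnessLib.Audit.Tags
import Summits.Ventures.ResidMod.Conjectures.ImprimitiveCertificates

/-!
# The root form of the pair-sum certificate implies `HasTwoBlocks` (TODO-29 remainder (b1); bus R308)

Honest framing: elementary Galois theory of rational sextics, PROVED; no curve, no Galois-image determination, no
modularity claim, no new census, nothing numerical.  The cell's rung-23a instrument `res23.py` certifies an
irreducible integer sextic `f` as imprimitive with TWO-element blocks by exhibiting an irreducible cubic `S` whose
roots are the three pair sums of a Galois-stable perfect matching of the six roots of `f`.  This file types the
ROOT FORM of that certificate and proves that it implies the tree's `HasTwoBlocks` (`ImprimitiveCertificates.lean`,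
p369982: a quadratic factor of `f` over the cubic field `ℚ[Y]/(S)`), hence `|Gal(f/ℚ)| ∣ 144` and `¬ Typical`
(`M23_not_typical_of_pairSum`; the sharp `∣ 48` follows verbatim from `M23_twoBlocks_card_dvd_48` of
`TwoBlocksSharp.lean`, bus R306, proposed separately and therefore not imported here).  What is NOT typed (b2): the
instrument's actual output is the integer divisibility `f | Res_Y(S̃(Y), lc⁶·f(Y/lc − x))`, which yields the root form
by the product formula for resultants; that step (resultants over `ℤ[x]`) is recorded, not formalised.  The exact
statements below were registered on the cell bus BEFORE any proof (R308, cell «pub-residmod», 2026-08-23).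

Root form.  `E/ℚ` finite Galois in which `F` (irreducible sextic) and `S` (irreducible cubic) split;
hypothesis `hpair`: every root `r` of `F` has a root `y` of `S` with `y − r` again a root of `F`.

Mechanism (counting, no resultants, no Vieta).  `T` = the six roots, `C(y) = {r ∈ T : y − r ∈ T}`; Galois transport
gives `σ C(y) = C(σ y)`, so `C(y₁) ≠ ∅` for a fixed root `y₁` of `S` (transitivity of `Gal` on the roots of the
irreducible `S`, Mathlib's `Gal.galAction_isPretransitive`).  `r ↦ y₁ − r` is an involution of `C(y₁)` without fixed
point (a fixed point `y₁/2` would generate a subfield of the cubic field `ℚ⟮y₁⟯`, but roots of `F` have degree `6`),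
so `|C(y₁)|` is even (`Equiv.Perm.two_dvd_card_support`); `|C(y₁)| = 6` is impossible, since then every root pairs
under `y₁` and (transport) under a second root `y₂`, and summing `y − r` over `T` gives `6·y₁ = 2·ΣT = 6·y₂`.  Hence
`C(y₁)` (if `|C| = 2`) or its complement in `T` (if `|C| = 4`) is a PAIR of roots stable under `Gal(E/ℚ⟮y₁⟯)`; the
symmetric functions of a stable pair lie in `Fix Gal(E/K) = K` (`IsGalois.fixedField_fixingSubgroup`), the monic
quadratic through the pair divides `F` in `E[X]` and the division descends to `K[X]` (`Polynomial.map_modByMonic`);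
finally `K = ℚ⟮y₁⟯ ≅ ℚ[Y]/(minpoly y₁) → ℚ[Y]/(S)` (`IntermediateField.adjoinRootEquivAdjoin`, `AdjoinRoot.lift`)
pushes the factorisation to `ℚ[Y]/(S)`.

Main results (all PROVED, axioms `propext`, `Classical.choice`, `Quot.sound` only):
* `exists_quadratic_factor_of_stable_pair` — a `Gal(E/K)`-stable pair of roots of `F` gives `q ∣ F` in `K[X]`,
  `deg q = 2`;
* `exists_quadratic_factor_of_pairSum` — the Galois-theoretic core over an arbitrary finite Galois `E/ℚ`;
* `hasTwoBlocks_of_pairSum` — for an integer sextic with `f 6 ≠ 0`, irreducible over `ℚ`, the root form of the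
  certificate in the splitting field of `f·S` gives `HasTwoBlocks f`;
* `M23_not_typical_of_pairSum` — bookkeeping with `M23_twoBlocks_card_dvd` (p369982): `|Gal| ∣ 144 ∧ ¬ Typical f`.
Technical notes: (i) as in `TwoBlocksSharp.lean`, over the base field `ℚ` the type of `SplittingField.splits` is
ascribed and `SplittingField.instNormal` is named, because instance search picks `DivisionRing.toRatAlgebra` for
`Algebra ℚ (SplittingField _)`; (ii) for the same reason the ring isomorphism `ℚ⟮y₁⟯ ≃+* ℚ[Y]/(minpoly y₁)` is
extracted from Mathlib's algebra equivalence with unification holes `(_)` rather than instance search.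
-/

open Polynomial Module

namespace Summit.Ventures.ResidMod.Conjectures

section Galois

open MulAction IntermediateField

/-- **A Galois-stable pair of roots gives a quadratic factor.**  Let `E/ℚ` be finite Galois, `K ≤ E`, and
`r₁ ≠ r₂` roots of `F ∈ ℚ[X]` in `E` such that every element of `Gal(E/K)` fixes or swaps them.  Then
`(X − r₁)(X − r₂)` has coefficients in `K = Fix Gal(E/K)` and divides `F` in `K[X]`. [folklore] -/
theorem exists_quadratic_factor_of_stable_pair {E : Type*} [Field E] [Algebra ℚ E] [FiniteDimensional ℚ E]
    [IsGalois ℚ E] (F : ℚ[X]) (K : IntermediateField ℚ E) {r₁ r₂ : E} (hne : r₁ ≠ r₂)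
    (h₁ : aeval r₁ F = 0) (h₂ : aeval r₂ F = 0)
    (hstab : ∀ σ : Gal(E/ℚ), σ ∈ K.fixingSubgroup → (σ r₁ = r₁ ∧ σ r₂ = r₂) ∨ (σ r₁ = r₂ ∧ σ r₂ = r₁)) :
    ∃ q r : K[X], q.natDegree = 2 ∧ F.map (algebraMap ℚ K) = q * r := by
  classical
  -- the symmetric functions of the pair lie in `K = Fix(Gal(E/K))`
  have hmemK : ∀ x : E, (∀ σ : Gal(E/ℚ), σ ∈ K.fixingSubgroup → σ x = x) → x ∈ K := by
    intro x hx
    rw [← IsGalois.fixedField_fixingSubgroup K, IntermediateField.mem_fixedField_iff]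
    exact hx
  have hs : r₁ + r₂ ∈ K := hmemK _ fun σ hσ => by
    rcases hstab σ hσ with ⟨e1, e2⟩ | ⟨e1, e2⟩
    · rw [map_add, e1, e2]
    · rw [map_add, e1, e2, add_comm]
  have hp : r₁ * r₂ ∈ K := hmemK _ fun σ hσ => by
    rcases hstab σ hσ with ⟨e1, e2⟩ | ⟨e1, e2⟩
    · rw [map_mul, e1, e2]
    · rw [map_mul, e1, e2, mul_comm]
  -- the quadratic over `K`
  set lin : K[X] := C (-(⟨r₁ + r₂, hs⟩ : K)) * X + C (⟨r₁ * r₂, hp⟩ : K) with hlin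
  set qK : K[X] := X ^ 2 + lin with hqK
  have hdeg : lin.degree < ((X : K[X]) ^ 2).degree := by
    rw [degree_X_pow]
    exact lt_of_le_of_lt degree_linear_le (by decide)
  have hdeg' : lin.degree < (2 : ℕ) := by rwa [degree_X_pow] at hdeg
  have hmonic : qK.Monic := monic_X_pow_add hdeg'
  have hqK2 : qK.natDegree = 2 := by
    rw [hqK, natDegree_add_eq_left_of_degree_lt hdeg, natDegree_X_pow]
  -- ... and over `E`
  have e1 : algebraMap K E (⟨r₁ + r₂, hs⟩ : K) = r₁ + r₂ := rfl
  have e2 : algebraMap K E (⟨r₁ * r₂, hp⟩ : K) = r₁ * r₂ := rfl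
  have hqE : qK.map (algebraMap K E) = (X - C r₁) * (X - C r₂) := by
    rw [hqK, hlin]
    simp only [Polynomial.map_add, Polynomial.map_mul, Polynomial.map_pow, Polynomial.map_neg, map_X, map_C,
      map_neg, e1, e2, C_add, C_mul]
    ring
  -- `(X − r₁)(X − r₂) ∣ F` in `E[X]`
  set FE : E[X] := F.map (algebraMap ℚ E) with hFE
  have hroot1 : FE.IsRoot r₁ := by rw [IsRoot.def, hFE, eval_map_algebraMap]; exact h₁
  have hg := mul_divByMonic_eq_iff_isRoot.mpr hroot1
  set g : E[X] := FE /ₘ (X - C r₁) with hg'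
  have hroot2 : g.IsRoot r₂ := by
    have h : eval r₂ FE = 0 := by rw [hFE, eval_map_algebraMap]; exact h₂
    rw [← hg, eval_mul, eval_sub, eval_X, eval_C, mul_eq_zero] at h
    exact h.resolve_left (sub_ne_zero.mpr hne.symm)
  have hh := mul_divByMonic_eq_iff_isRoot.mpr hroot2
  have hdvdE : qK.map (algebraMap K E) ∣ FE := by
    rw [hqE]
    refine ⟨g /ₘ (X - C r₂), ?_⟩
    rw [mul_assoc, hh, hg]
  -- descend to `K[X]`
  have hmod : F.map (algebraMap ℚ K) %ₘ qK = 0 := by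
    apply Polynomial.map_injective (algebraMap K E) (algebraMap K E).injective
    rw [Polynomial.map_modByMonic _ hmonic, Polynomial.map_map, ← IsScalarTower.algebraMap_eq ℚ K E,
      Polynomial.map_zero]
    exact (modByMonic_eq_zero_iff_dvd (hmonic.map _)).mpr hdvdE
  obtain ⟨r, hr⟩ := (modByMonic_eq_zero_iff_dvd hmonic).mp hmod
  exact ⟨qK, r, hqK2, hr⟩

/-- **Core of (b1): the root form of the pair-sum certificate gives a quadratic factor over `ℚ[Y]/(S)`.**
Let `E/ℚ` be finite Galois; `F` an irreducible sextic and `S` an irreducible cubic over `ℚ`, both split in `E`;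
assume every root `r` of `F` has a root `y` of `S` with `y − r` again a root of `F`.  With `T` = the six roots
and `C(y) = {r ∈ T : y − r ∈ T}`: `σ C(y) = C(σy)`, so `C(y₁) ≠ ∅` for a fixed root `y₁` (transitivity on the
roots of `S`); `r ↦ y₁ − r` is a fixed-point-free involution of `C(y₁)` (a fixed point `y₁/2` would lie in the
cubic field `ℚ(y₁)`, but roots of `F` have degree `6`), so `|C(y₁)|` is even; `|C(y₁)| = 6` would give
`6y₁ = 2 ΣT = 6y₂` for a second root `y₂ ≠ y₁`; hence `C(y₁)` or its complement is a `Gal(E/ℚ(y₁))`-stable pair,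
which `exists_quadratic_factor_of_stable_pair` turns into a quadratic factor over `ℚ(y₁) ≅ ℚ[Y]/(S)`.
[elementary Galois theory] -/
theorem exists_quadratic_factor_of_pairSum {E : Type*} [Field E] [Algebra ℚ E] [FiniteDimensional ℚ E]
    [IsGalois ℚ E] {F S : ℚ[X]} (hirr : Irreducible F) (hF6 : F.natDegree = 6) (hS3 : S.natDegree = 3)
    (hSirr : Irreducible S) (hsplitF : (F.map (algebraMap ℚ E)).Splits)
    (hsplitS : (S.map (algebraMap ℚ E)).Splits)
    (hpair : ∀ r ∈ F.rootSet E, ∃ y ∈ S.rootSet E, y - r ∈ F.rootSet E) :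
    ∃ q r : (AdjoinRoot S)[X], q.natDegree = 2 ∧ F.map (algebraMap ℚ (AdjoinRoot S)) = q * r := by
  classical
  haveI : CharZero E := charZero_of_injective_algebraMap (algebraMap ℚ E).injective
  have hF0 : F ≠ 0 := hirr.ne_zero
  have hS0 : S ≠ 0 := hSirr.ne_zero
  have hFE0 : F.map (algebraMap ℚ E) ≠ 0 := (Polynomial.map_ne_zero_iff (algebraMap ℚ E).injective).mpr hF0
  have hSE0 : S.map (algebraMap ℚ E) ≠ 0 := (Polynomial.map_ne_zero_iff (algebraMap ℚ E).injective).mpr hS0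
  have hsepF : F.Separable := hirr.separable
  have hsepS : S.Separable := hSirr.separable
  -- the six roots of `F` and the three roots of `S` in `E`, as finsets
  set T : Finset E := (F.aroots E).toFinset with hT
  set U : Finset E := (S.aroots E).toFinset with hU
  have hTmem : ∀ r, r ∈ T ↔ aeval r F = 0 := by
    intro r
    rw [hT, Multiset.mem_toFinset, mem_aroots']
    exact ⟨fun h => h.2, fun h => ⟨hFE0, h⟩⟩
  have hUmem : ∀ y, y ∈ U ↔ aeval y S = 0 := by
    intro y
    rw [hU, Multiset.mem_toFinset, mem_aroots']
    exact ⟨fun h => h.2, fun h => ⟨hSE0, h⟩⟩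
  have hTroot : ∀ r, r ∈ F.rootSet E ↔ r ∈ T := by
    intro r; rw [mem_rootSet, hTmem]; exact ⟨fun h => h.2, fun h => ⟨hF0, h⟩⟩
  have hUroot : ∀ y, y ∈ S.rootSet E ↔ y ∈ U := by
    intro y; rw [mem_rootSet, hUmem]; exact ⟨fun h => h.2, fun h => ⟨hS0, h⟩⟩
  have hTcard : T.card = 6 := by
    rw [hT, Multiset.toFinset_card_of_nodup (nodup_roots hsepF.map), ← hsplitF.natDegree_eq_card_roots,
      natDegree_map_eq_of_injective (algebraMap ℚ E).injective, hF6]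
  have hUcard : U.card = 3 := by
    rw [hU, Multiset.toFinset_card_of_nodup (nodup_roots hsepS.map), ← hsplitS.natDegree_eq_card_roots,
      natDegree_map_eq_of_injective (algebraMap ℚ E).injective, hS3]
  -- Galois transport of roots
  have hTσ : ∀ (σ : Gal(E/ℚ)) {r : E}, r ∈ T → σ r ∈ T := by
    intro σ r hr
    rw [hTmem] at hr ⊢
    rw [aeval_algHom_apply, hr, map_zero]
  have hUσ : ∀ (σ : Gal(E/ℚ)) {y : E}, y ∈ U → σ y ∈ U := by
    intro σ y hy
    rw [hUmem] at hy ⊢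
    rw [aeval_algHom_apply, hy, map_zero]
  -- roots of `F` have degree `6` over `ℚ`
  have hdeg6 : ∀ r ∈ T, finrank ℚ ℚ⟮r⟯ = 6 := by
    intro r hr
    rw [adjoin.finrank (.of_finite ℚ r), ← minpoly.eq_of_irreducible hirr ((hTmem r).mp hr),
      natDegree_mul_C (inv_ne_zero (leadingCoeff_ne_zero.mpr hF0)), hF6]
  -- two distinct roots `y₁ ≠ y₂` of `S`; the cubic field `K = ℚ⟮y₁⟯`
  obtain ⟨y₁, hy₁, y₂, hy₂, hy12⟩ := Finset.one_lt_card.mp (by rw [hUcard]; norm_num)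
  have hy₁S : aeval y₁ S = 0 := (hUmem y₁).mp hy₁
  have hy₁int : IsIntegral ℚ y₁ := .of_finite ℚ y₁
  set K : IntermediateField ℚ E := ℚ⟮y₁⟯ with hKdef
  have hK3 : finrank ℚ K = 3 := by
    rw [hKdef, adjoin.finrank hy₁int, ← minpoly.eq_of_irreducible hSirr hy₁S,
      natDegree_mul_C (inv_ne_zero (leadingCoeff_ne_zero.mpr hS0)), hS3]
  have hy₁K : y₁ ∈ K := by rw [hKdef]; exact mem_adjoin_simple_self ℚ y₁
  have hfixy : ∀ σ : Gal(E/ℚ), σ ∈ K.fixingSubgroup → σ y₁ = y₁ := fun σ hσ =>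
    (IntermediateField.mem_fixingSubgroup_iff _ _).mp hσ y₁ hy₁K
  -- transitivity of `Gal(E/ℚ)` on the roots of `S`
  haveI : Fact ((S.map (algebraMap ℚ E)).Splits) := ⟨hsplitS⟩
  haveI : IsPretransitive S.Gal (S.rootSet E) := Gal.galAction_isPretransitive S E hSirr
  have htrans : ∀ y ∈ U, ∀ y' ∈ U, ∃ σ : Gal(E/ℚ), σ y = y' := by
    intro y hy y' hy'
    obtain ⟨g, hg⟩ := exists_smul_eq S.Gal (⟨y, (hUroot y).mpr hy⟩ : S.rootSet E) ⟨y', (hUroot y').mpr hy'⟩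
    obtain ⟨σ, rfl⟩ := Gal.restrict_surjective S E g
    refine ⟨σ, ?_⟩
    have := congrArg Subtype.val hg
    rwa [Gal.restrict_smul] at this
  -- the sets `C(y)`
  have hCσ : ∀ (σ : Gal(E/ℚ)) {y r : E}, r ∈ T → y - r ∈ T → σ r ∈ T ∧ σ y - σ r ∈ T := by
    intro σ y r hr hyr
    exact ⟨hTσ σ hr, by rw [← map_sub]; exact hTσ σ hyr⟩
  set Cf : Finset E := T.filter (fun r => y₁ - r ∈ T) with hCf
  have hCmem : ∀ r, r ∈ Cf ↔ r ∈ T ∧ y₁ - r ∈ T := fun r => by rw [hCf, Finset.mem_filter]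
  have hCsub : Cf ⊆ T := Finset.filter_subset _ _
  -- `Gal(E/K)` preserves `C(y₁)`
  have hCstab : ∀ σ : Gal(E/ℚ), σ ∈ K.fixingSubgroup → ∀ r ∈ Cf, σ r ∈ Cf := by
    intro σ hσ r hr
    obtain ⟨hrT, hyr⟩ := (hCmem r).mp hr
    have h := hCσ σ hrT hyr
    rw [hfixy σ hσ] at h
    exact (hCmem _).mpr h
  -- `C(y₁)` is non-empty: some root pairs with some `y`, which a Galois element moves to `y₁`
  have hCne : Cf.Nonempty := by
    obtain ⟨r₀, hr₀⟩ : T.Nonempty := Finset.card_pos.mp (by rw [hTcard]; norm_num)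
    obtain ⟨y, hy, hyr⟩ := hpair r₀ ((hTroot r₀).mpr hr₀)
    obtain ⟨σ, hσy⟩ := htrans y ((hUroot y).mp hy) y₁ hy₁
    refine ⟨σ r₀, (hCmem _).mpr ?_⟩
    have h := hCσ σ hr₀ ((hTroot _).mp hyr)
    rwa [hσy] at h
  -- `r ↦ y₁ − r` is a fixed-point-free involution of `C(y₁)`, so `|C(y₁)|` is even
  have hnofix : ∀ r ∈ T, y₁ - r ≠ r := by
    intro r hr h
    have hr2 : r = (2⁻¹ : ℚ) • y₁ := by
      have h' : y₁ = r + r := by linear_combination h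
      rw [Algebra.smul_def, map_inv₀, map_ofNat, h']
      field_simp
      ring
    have hrK : r ∈ K := by rw [hr2]; exact K.smul_mem hy₁K
    have hle : ℚ⟮r⟯ ≤ K := adjoin_simple_le_iff.mpr hrK
    have := IntermediateField.finrank_le_of_le_right hle
    rw [hdeg6 r hr, hK3] at this
    omega
  have hmemC' : ∀ x : E, x ∈ Cf → y₁ - x ∈ Cf := by
    intro x hx
    obtain ⟨hxT, hyx⟩ := (hCmem x).mp hx
    exact (hCmem _).mpr ⟨hyx, by rw [sub_sub_cancel]; exact hxT⟩
  let τ : Equiv.Perm {x // x ∈ Cf} :=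
    { toFun := fun x => ⟨y₁ - x.1, hmemC' x.1 x.2⟩
      invFun := fun x => ⟨y₁ - x.1, hmemC' x.1 x.2⟩
      left_inv := fun x => Subtype.ext (sub_sub_cancel y₁ x.1)
      right_inv := fun x => Subtype.ext (sub_sub_cancel y₁ x.1) }
  have hτ : ∀ x : {x // x ∈ Cf}, ((τ x : {x // x ∈ Cf}) : E) = y₁ - x.1 := fun x => rfl
  have hτ2 : τ ^ 2 = 1 := by
    ext x
    rw [sq, Equiv.Perm.mul_apply, hτ, hτ, sub_sub_cancel, Equiv.Perm.one_apply]
  have hsupp : τ.support = Finset.univ := by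
    refine Finset.eq_univ_iff_forall.mpr fun x => Equiv.Perm.mem_support.mpr fun h => ?_
    have h' := congrArg Subtype.val h
    rw [hτ] at h'
    exact hnofix x.1 (hCsub x.2) h'
  have heven : 2 ∣ Cf.card := by
    have h := Equiv.Perm.two_dvd_card_support hτ2
    rwa [hsupp, Finset.card_univ, Fintype.card_coe] at h
  -- `|C(y₁)| ≠ 6`: otherwise every root pairs under `y₁`, hence (transport) under `y₂`, and `6y₁ = 2ΣT = 6y₂`
  have hsum : ∀ y : E, (∀ r ∈ T, y - r ∈ T) → (6 : E) * y = 2 * ∑ r ∈ T, r := by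
    intro y hy
    have h1 : ∑ r ∈ T, (y - r) = ∑ r ∈ T, r :=
      Finset.sum_nbij' (fun r => y - r) (fun r => y - r) hy hy (fun r _ => sub_sub_cancel y r)
        (fun r _ => sub_sub_cancel y r) (fun r _ => rfl)
    rw [Finset.sum_sub_distrib, Finset.sum_const, hTcard, nsmul_eq_mul] at h1
    push_cast at h1
    linear_combination h1
  have hC6 : Cf.card ≠ 6 := by
    intro h6
    have hCT : Cf = T := Finset.eq_of_subset_of_card_le hCsub (by rw [hTcard, h6])
    have hall₁ : ∀ r ∈ T, y₁ - r ∈ T := fun r hr => ((hCmem r).mp (hCT ▸ hr)).2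
    obtain ⟨σ, hσ⟩ := htrans y₁ hy₁ y₂ hy₂
    have hall₂ : ∀ r ∈ T, y₂ - r ∈ T := by
      intro r hr
      have hr' : σ.symm r ∈ T := hTσ σ.symm hr
      have h := hTσ σ (hall₁ _ hr')
      rwa [map_sub, hσ, AlgEquiv.apply_symm_apply] at h
    have h := (hsum y₁ hall₁).trans (hsum y₂ hall₂).symm
    exact hy12 (mul_left_cancel₀ (by norm_num : (6 : E) ≠ 0) h)
  -- hence `|C(y₁)| ∈ {2, 4}` and `C(y₁)` or its complement is a `Gal(E/K)`-stable pair of roots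
  have hCle : Cf.card ≤ 6 := hTcard ▸ Finset.card_le_card hCsub
  have hCpos : 0 < Cf.card := Finset.card_pos.mpr hCne
  obtain ⟨B, hBT, hB2, hBstab⟩ : ∃ B : Finset E, B ⊆ T ∧ B.card = 2 ∧
      ∀ σ : Gal(E/ℚ), σ ∈ K.fixingSubgroup → ∀ r ∈ B, σ r ∈ B := by
    have h24 : Cf.card = 2 ∨ Cf.card = 4 := by omega
    rcases h24 with h2 | h4
    · exact ⟨Cf, hCsub, h2, hCstab⟩
    · refine ⟨T \ Cf, Finset.sdiff_subset, by rw [Finset.card_sdiff_of_subset hCsub, hTcard, h4], ?_⟩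
      intro σ hσ r hr
      rw [Finset.mem_sdiff] at hr ⊢
      refine ⟨hTσ σ hr.1, fun hσr => hr.2 ?_⟩
      have hsymm : σ.symm ∈ K.fixingSubgroup := K.fixingSubgroup.inv_mem hσ
      have h := hCstab σ.symm hsymm _ hσr
      rwa [AlgEquiv.symm_apply_apply] at h
  obtain ⟨r₁, r₂, hne, hBeq⟩ := Finset.card_eq_two.mp hB2
  have hr₁B : r₁ ∈ B := by rw [hBeq]; simp
  have hr₂B : r₂ ∈ B := by rw [hBeq]; simp
  have hmemB : ∀ x ∈ B, x = r₁ ∨ x = r₂ := by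
    intro x hx
    rw [hBeq, Finset.mem_insert, Finset.mem_singleton] at hx
    exact hx
  have hstab2 : ∀ σ : Gal(E/ℚ), σ ∈ K.fixingSubgroup →
      (σ r₁ = r₁ ∧ σ r₂ = r₂) ∨ (σ r₁ = r₂ ∧ σ r₂ = r₁) := by
    intro σ hσ
    have h1 := hmemB _ (hBstab σ hσ r₁ hr₁B)
    have h2 := hmemB _ (hBstab σ hσ r₂ hr₂B)
    rcases h1 with h1 | h1
    · rcases h2 with h2 | h2
      · exact absurd (σ.injective (h2.trans h1.symm)) hne.symm
      · exact Or.inl ⟨h1, h2⟩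
    · rcases h2 with h2 | h2
      · exact Or.inr ⟨h1, h2⟩
      · exact absurd (σ.injective (h1.trans h2.symm)) hne
  -- the quadratic factor over `K`, pushed to `ℚ[Y]/(S)` along `K = ℚ⟮y₁⟯ ≅ ℚ[Y]/(minpoly y₁) → ℚ[Y]/(S)`
  obtain ⟨qK, rK, hqK2, hqrK⟩ := exists_quadratic_factor_of_stable_pair F K hne
    ((hTmem r₁).mp (hBT hr₁B)) ((hTmem r₂).mp (hBT hr₂B)) hstab2
  have hmin : minpoly ℚ y₁ = S * C (S.leadingCoeff)⁻¹ := (minpoly.eq_of_irreducible hSirr hy₁S).symm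
  have hev : (minpoly ℚ y₁).eval₂ (AdjoinRoot.of S) (AdjoinRoot.root S) = 0 := by
    rw [hmin, eval₂_mul, AdjoinRoot.eval₂_root, zero_mul]
  let ρ : AdjoinRoot (minpoly ℚ y₁) →+* AdjoinRoot S := AdjoinRoot.lift (AdjoinRoot.of S) (AdjoinRoot.root S) hev
  -- (no type ascription: Mathlib states the equivalence for the intermediate field's own `ℚ`-algebra structure)
  let e := adjoinRootEquivAdjoin ℚ hy₁int
  -- the `(_)` holes are filled by unification with the type of `e`, not by instance search (which would pick
  -- `DivisionRing.toRatAlgebra` for `Algebra ℚ K`, not reducibly the structure Mathlib states `e` for)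
  let e' : K ≃+* AdjoinRoot (minpoly ℚ y₁) := (@AlgEquiv.toRingEquiv _ _ _ (_) (_) (_) (_) (_) e).symm
  let φ : K →+* AdjoinRoot S := ρ.comp e'.toRingHom
  have hφ : φ.comp (algebraMap ℚ K) = algebraMap ℚ (AdjoinRoot S) := Subsingleton.elim _ _
  refine ⟨qK.map φ, rK.map φ, ?_, ?_⟩
  · haveI : Fact (Irreducible S) := ⟨hSirr⟩
    rw [natDegree_map_eq_of_injective φ.injective, hqK2]
  · rw [← hφ, ← Polynomial.map_map, hqrK, Polynomial.map_mul]

end Galois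

/-- PROVED (TODO-29 remainder part 2 (b1), bus R308): the ROOT FORM of the rung-23a `IRRED` certificate implies
`HasTwoBlocks`.  If `f` is an irreducible integer sextic and `S ∈ ℚ[X]` an irreducible cubic such that, in the
splitting field of `f·S`, every root `r` of `f` has a root `y` of `S` with `y − r` again a root of `f` (the pair sums
of a Galois-stable perfect matching are the roots of `S`), then `f` has a quadratic factor over `ℚ[Y]/(S)`.  What is
NOT typed here (b2): the instrument `res23.py` certifies `f | Res_Y(S̃(Y), lc⁶ f(Y/lc − x))` over `ℤ`, which gives the
root form by the product formula for resultants. -/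
theorem hasTwoBlocks_of_pairSum (f : Sextic) (hf : f 6 ≠ 0) (hirr : Irreducible (toRatPoly f)) (S : ℚ[X])
    (hS3 : S.natDegree = 3) (hSirr : Irreducible S)
    (hpair : ∀ r ∈ (toRatPoly f).rootSet (toRatPoly f * S).SplittingField,
      ∃ y ∈ S.rootSet (toRatPoly f * S).SplittingField,
        y - r ∈ (toRatPoly f).rootSet (toRatPoly f * S).SplittingField) :
    HasTwoBlocks f := by
  have hF6 : (toRatPoly f).natDegree = 6 := natDegree_toRatPoly hf
  have hFS0 : toRatPoly f * S ≠ 0 := mul_ne_zero hirr.ne_zero hSirr.ne_zero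
  -- see `TwoBlocksSharp.lean`: over the base field `ℚ` the type of `SplittingField.splits` is ascribed and `Normal`
  -- is supplied by name (the two `ℚ`-algebra structures on a splitting field agree by `rfl`, not reducibly)
  have hsplit : ((toRatPoly f * S).map (algebraMap ℚ (toRatPoly f * S).SplittingField)).Splits :=
    SplittingField.splits (toRatPoly f * S)
  have hne : (toRatPoly f * S).map (algebraMap ℚ (toRatPoly f * S).SplittingField) ≠ 0 :=
    (Polynomial.map_ne_zero_iff (algebraMap ℚ _).injective).mpr hFS0
  haveI : IsGalois ℚ (toRatPoly f * S).SplittingField :=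
    IsGalois.mk (to_normal := SplittingField.instNormal (toRatPoly f * S))
  obtain ⟨q, r, hq2, hqr⟩ := exists_quadratic_factor_of_pairSum hirr hF6 hS3 hSirr
    (hsplit.of_dvd hne (Polynomial.map_dvd _ (dvd_mul_right _ _)))
    (hsplit.of_dvd hne (Polynomial.map_dvd _ (dvd_mul_left _ _))) hpair
  exact ⟨S, hS3, hSirr, q, r, hq2, hqr⟩

/-- Bookkeeping corollary (with `M23_twoBlocks_card_dvd`, p369982): a non-degenerate irreducible sextic satisfying
the root form of the pair-sum certificate has `|Gal(f/ℚ)| ∣ 144`, hence is never `Typical` (`|Gal| ≥ 360`); the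
sharp `∣ 48` follows in the same way from `M23_twoBlocks_card_dvd_48` (`TwoBlocksSharp.lean`, proposed separately,
bus R306). [bookkeeping] -/
theorem M23_not_typical_of_pairSum (f : Sextic) (hnd : NonDegenerate f) (hirr : Irreducible (toRatPoly f))
    (S : ℚ[X]) (hS3 : S.natDegree = 3) (hSirr : Irreducible S)
    (hpair : ∀ r ∈ (toRatPoly f).rootSet (toRatPoly f * S).SplittingField,
      ∃ y ∈ S.rootSet (toRatPoly f * S).SplittingField,
        y - r ∈ (toRatPoly f).rootSet (toRatPoly f * S).SplittingField) :
    Nat.card (toRatPoly f).Gal ∣ 144 ∧ ¬ Typical f := by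
  have h144 := M23_twoBlocks_card_dvd f hnd (hasTwoBlocks_of_pairSum f hnd.1 hirr S hS3 hSirr hpair)
  refine ⟨h144, fun htyp => ?_⟩
  unfold Typical at htyp
  have := Nat.le_of_dvd (by norm_num) h144
  omega

end Summit.Ventures.ResidMod.Conjectures
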